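import Literature.RingTheory.LocalCohomology.CechFiniteness
import Literature.RingTheory.LocalCohomology.CechLowDegrees
import HarnessLib

/-!
# Twisted Čech cochains: line bundles on the punctured spectrum, lifting and obstructions

Topic `Literature/RingTheory/LocalCohomology`, sequel of `CechComplex.lean` … `CechFiniteness.lean`.
For an `R`-algebra `A` the localisations `A_{y_t}` are rings (Mathlib's algebra structure on
`LocalizedModule`), the restriction maps are multiplicative (`res_mul`, from `CechLowDegrees.lean`), and a *unit `1`-cocycle*
`u ∈ Č¹(A)` (`IsMulCocycle u`, `u(i,j) u(j,k) = u(i,k)`) is the transition datum of a line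
bundle on the punctured spectrum covered by the `D(y_i)`. This file provides:

* the **twisted differential** `dT u n = dC n + (u(t0,t1) - 1)·(face 0)` (`dT`, `dT_zero_apply`,
  `dT_one_apply`, `dT_one_dT_zero`), functorial for algebra maps (`cechObjMap_dT`) and for
  semilinear maps such as `g^k · : A/g → A/g^{k+1}` (`cechObjMap_dT_semilinear`);
* **lifting of unit cocycles** along a square-zero thickening `A'' →m A →π A'` when every Čech
  `2`-cocycle of `A''` is a coboundary (`exists_lift_mulCocycle`; SGA 2 XI 3.16: `Pic(U_{k+1}) →
  Pic(U_k)` is onto when `H³_𝔪(A'') = 0`), by an explicit computation with the defect cocycle;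
* twisted sections `TZ0 u = ker d_u`, twisted `TH2 u = ker d_u¹ / im d_u⁰`, and the
  **obstruction relation** `IsObs π m u w σ e` (a section `σ` over `A'` has obstruction class
  `e ∈ TH2 w` to lifting over `A`), with existence, vanishing ⇔ lifting, additivity, the submodule
  of obstruction classes (`obsSubmodule`) and compatibility with the thickening maps
  (`IsObs.map_gamma`).

Everything is proved; no named facts. Infrastructure for Grothendieck's parafactoriality theorem
SGA 2 XI 3.13 (ii) (`Literature/RingTheory/RegularLocalRing/GrothendieckSamuelHypersurface*`).

## References

* [Grothendieck1968SGA2] A. Grothendieck, SGA 2, Exp. XI, Lemme 3.16 and proof of Thm. 3.13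
  (arXiv:math/0511279, pp. 70–72).
* [Eisenbud2005] D. Eisenbud, *The Geometry of Syzygies*, GTM 229, Appendix 1, Thm. A1.3.
-/

noncomputable section

open CategoryTheory AlgebraicTopology

universe u

namespace Literature.RingTheory.LocalCohomology

variable {R : Type u} [CommRing R] {s : ℕ} (y : Fin s → R) (M : Type u) [AddCommGroup M]
  [Module R M]

/-! ## Ring structure on the localisations of an algebra (for unit cocycles) -/

section AlgebraLoc

variable {y}
variable {A : Type u} [CommRing A] [Algebra R A]

/-- On `A_{y_t}` (an `R`-algebra `A`), a power of `y_u` acts injectively when `y_u` divides a power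
of `y_t`. [folklore] -/
theorem smul_injective_cechLoc_of_dvd {n n' : ℕ} {u : Fin n' → Fin s} {t : Fin n → Fin s}
    (h : ∃ K, tupleProd y u ∣ tupleProd y t ^ K) (x : Submonoid.powers (tupleProd y u))
    {N : Type u} [AddCommGroup N] [Module R N] {a b : CechLoc y N t}
    (hab : (x : R) • a = (x : R) • b) : a = b := by
  have hu := isUnit_algebraMap_end_cechLoc_of_dvd (M := N) h x
  obtain ⟨e, he⟩ := hu
  have h1 : (e : Module.End R (CechLoc y N t)) a = (e : Module.End R (CechLoc y N t)) b := by
    rw [he, Module.algebraMap_end_apply, Module.algebraMap_end_apply]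
    exact hab
  have h2 : ∀ z, ((e⁻¹ : (Module.End R (CechLoc y N t))ˣ) : Module.End R (CechLoc y N t))
      ((e : Module.End R (CechLoc y N t)) z) = z := fun z => by
    rw [← Module.End.mul_apply, Units.inv_mul, Module.End.one_apply]
  rw [← h2 a, ← h2 b, h1]

end AlgebraLoc

/-! ## Twisted Čech cochains in low degrees (line bundles on the punctured spectrum) -/

section Twisted

variable {y M}
variable {A : Type u} [CommRing A] [Algebra R A]

/-- Rewriting a restriction along equal face maps. [folklore] -/
theorem res_congr {n n' : ℕ} (t : Fin n → Fin s) {θ θ' : Fin n' → Fin n} (h : θ = θ')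
    (c : ∀ u : Fin n' → Fin s, CechLoc y M u) :
    res y M t θ (c (t ∘ θ)) = res y M t θ' (c (t ∘ θ')) := by
  subst h
  rfl

/-- Rewriting an iterated restriction along a composite face map. [folklore] -/
theorem res_res_congr {n n' n'' : ℕ} (t : Fin n → Fin s) (θ₁ : Fin n' → Fin n)
    (θ₂ : Fin n'' → Fin n') {θ' : Fin n'' → Fin n} (h : θ₁ ∘ θ₂ = θ')
    (c : ∀ u : Fin n'' → Fin s, CechLoc y M u) :
    res y M t θ₁ (res y M (t ∘ θ₁) θ₂ (c ((t ∘ θ₁) ∘ θ₂))) = res y M t θ' (c (t ∘ θ')) := by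
  subst h
  exact LinearMap.congr_fun (res_comp y M t θ₁ θ₂) (c ((t ∘ θ₁) ∘ θ₂))

/-- The twist `u(t a, t b)` restricted to `A_{y_t}` (edge `(a, b)` of the simplex `t`). [folklore] -/
def uAt (u : CechObj y A 1) {n : ℕ} (t : Fin (n + 1) → Fin s) (a b : Fin (n + 1)) : CechLoc y A t :=
  res y A t ![a, b] (u (t ∘ ![a, b]))

/-- The twisting correction of the differential: `(u(t0,t1) - 1) · c(t ∘ δ₀)|`. [folklore] -/
def twistCorr (u : CechObj y A 1) (n : ℕ) : CechObj y A n →ₗ[R] CechObj y A (n + 1) where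
  toFun c t := (uAt u t 0 1 - 1) * res y A t (Fin.succAbove 0) (c (t ∘ Fin.succAbove 0))
  map_add' c c' := by
    funext t
    simp only [Pi.add_apply, map_add, mul_add]
  map_smul' r c := by
    funext t
    simp only [Pi.smul_apply, LinearMap.map_smul, RingHom.id_apply, mul_smul_comm]

/-- The **twisted Čech differential** `Č^n(A) → Č^{n+1}(A)` of the line bundle with transition
functions `u`: the face `δ₀` (dropping the first index) is followed by multiplication with
`u(t 0, t 1)` (change of trivialisation). [folklore] -/
def dT (u : CechObj y A 1) (n : ℕ) : CechObj y A n →ₗ[R] CechObj y A (n + 1) :=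
  dC n + twistCorr u n

/-- Unfolding of the twisted differential. [folklore] -/
theorem dT_apply (u : CechObj y A 1) (n : ℕ) (c : CechObj y A n) (t : Fin (n + 2) → Fin s) :
    dT u n c t = dC n c t +
      (uAt u t 0 1 - 1) * res y A t (Fin.succAbove 0) (c (t ∘ Fin.succAbove 0)) := rfl

/-- Degree `0`: `(d_u σ)(i,j) = u(i,j) σ(j)| - σ(i)|`. [folklore] -/
theorem dT_zero_apply (u : CechObj y A 1) (c : CechObj y A 0) (t : Fin 2 → Fin s) :
    dT u 0 c t = uAt u t 0 1 * res y A t (Fin.succAbove 0) (c (t ∘ Fin.succAbove 0)) -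
      res y A t (Fin.succAbove 1) (c (t ∘ Fin.succAbove 1)) := by
  rw [dT_apply, dC_apply, Fin.sum_univ_two]
  simp only [Fin.val_zero, pow_zero, one_smul, Fin.val_one, pow_one, neg_smul, one_smul]
  ring

/-- Degree `1`: `(d_u w)(i,j,k) = u(i,j) w(j,k)| - w(i,k)| + w(i,j)|`. [folklore] -/
theorem dT_one_apply (u : CechObj y A 1) (w : CechObj y A 1) (t : Fin 3 → Fin s) :
    dT u 1 w t = uAt u t 0 1 * res y A t (Fin.succAbove 0) (w (t ∘ Fin.succAbove 0)) -
      res y A t (Fin.succAbove 1) (w (t ∘ Fin.succAbove 1)) +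
      res y A t (Fin.succAbove 2) (w (t ∘ Fin.succAbove 2)) := by
  rw [dT_apply, dC_apply, Fin.sum_univ_three]
  simp only [Fin.val_zero, pow_zero, one_smul, Fin.val_one, pow_one, neg_smul, one_smul,
    Fin.val_two]
  norm_num
  ring

/-- `u(i,j)` in degree `1` is `u` itself. [folklore] -/
theorem uAt_zero_one (u : CechObj y A 1) (t : Fin 2 → Fin s) : uAt u t 0 1 = u t := by
  have h : (![0, 1] : Fin 2 → Fin 2) = id := by
    funext k; fin_cases k <;> rfl
  unfold uAt
  rw [show res y A t ![0, 1] (u (t ∘ ![0, 1])) = res y A t id (u (t ∘ id)) from by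
    rw [h], res_id]
  rfl

/-- The **multiplicative cocycle condition** `u(i,j)·u(j,k) = u(i,k)` in `A_{y_i y_j y_k}`.
[folklore] -/
def IsMulCocycle (u : CechObj y A 1) : Prop :=
  ∀ t : Fin 3 → Fin s,
    uAt u t 0 1 * res y A t (Fin.succAbove 0) (u (t ∘ Fin.succAbove 0)) =
      res y A t (Fin.succAbove 1) (u (t ∘ Fin.succAbove 1))

/-- `d_u ∘ d_u = 0` in degree `0` for a multiplicative cocycle `u`. [folklore] -/
theorem dT_one_dT_zero (u : CechObj y A 1) (hu : IsMulCocycle u) (c : CechObj y A 0) :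
    dT u 1 (dT u 0 c) = 0 := by
  funext t
  rw [dT_one_apply, Pi.zero_apply]
  simp only [dT_zero_apply, map_sub, res_mul]
  -- face identities `Fin 1 → Fin 3`: name the three vertices
  have k00 : (Fin.succAbove (0 : Fin 3)) ∘ (Fin.succAbove (0 : Fin 2)) = fun _ => 2 := by
    funext k; fin_cases k; rfl
  have k01 : (Fin.succAbove (0 : Fin 3)) ∘ (Fin.succAbove (1 : Fin 2)) = fun _ => 1 := by
    funext k; fin_cases k; rfl
  have k10 : (Fin.succAbove (1 : Fin 3)) ∘ (Fin.succAbove (0 : Fin 2)) = fun _ => 2 := by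
    funext k; fin_cases k; rfl
  have k11 : (Fin.succAbove (1 : Fin 3)) ∘ (Fin.succAbove (1 : Fin 2)) = fun _ => 0 := by
    funext k; fin_cases k; rfl
  have k20 : (Fin.succAbove (2 : Fin 3)) ∘ (Fin.succAbove (0 : Fin 2)) = fun _ => 1 := by
    funext k; fin_cases k; rfl
  have k21 : (Fin.succAbove (2 : Fin 3)) ∘ (Fin.succAbove (1 : Fin 2)) = fun _ => 0 := by
    funext k; fin_cases k; rfl
  -- the restricted twists: `u(t∘δ₀) ↦ u(j,k)`, `u(t∘δ₂) ↦ u(i,j)`: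
  have hu0 : res y A t (Fin.succAbove 0) (uAt u (t ∘ Fin.succAbove 0) 0 1) =
      res y A t (Fin.succAbove 0) (u (t ∘ Fin.succAbove 0)) := by rw [uAt_zero_one]
  have hu1 : res y A t (Fin.succAbove 1) (uAt u (t ∘ Fin.succAbove 1) 0 1) =
      res y A t (Fin.succAbove 1) (u (t ∘ Fin.succAbove 1)) := by rw [uAt_zero_one]
  have hu2 : res y A t (Fin.succAbove 2) (uAt u (t ∘ Fin.succAbove 2) 0 1) = uAt u t 0 1 := by
    rw [uAt_zero_one]
    unfold uAt
    have h : (![0, 1] : Fin 2 → Fin 3) = Fin.succAbove 2 := by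
      funext k; fin_cases k <;> rfl
    rw [h]
  rw [hu0, hu1, hu2, res_res_congr t _ _ k00 c, res_res_congr t _ _ k01 c,
    res_res_congr t _ _ k10 c, res_res_congr t _ _ k11 c, res_res_congr t _ _ k20 c,
    res_res_congr t _ _ k21 c, ← hu t]
  ring

end Twisted

/-! ### Functoriality of the twisted differential -/

section TwistedFunctor

variable {y M}
variable {A A' : Type u} [CommRing A] [Algebra R A] [CommRing A'] [Algebra R A']

/-- Pointwise form of `res_comp_locMap`. [folklore] -/
theorem res_locMap_apply {N P : Type u} [AddCommGroup N] [Module R N] [AddCommGroup P] [Module R P]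
    (φ : N →ₗ[R] P) {n n' : ℕ} (t : Fin n → Fin s) (θ : Fin n' → Fin n) (x : CechLoc y N (t ∘ θ)) :
    res y P t θ (locMap y φ (t ∘ θ) x) = locMap y φ t (res y N t θ x) :=
  LinearMap.congr_fun (res_comp_locMap y φ t θ) x

/-- **Semilinearity.** If `m : A' → A` is `R`-linear and `π`-semilinear (`m (π a · x) = a · m x`,
e.g. `A' = A/gA`, `m = ` multiplication by `g^k` into `A/g^{k+1}`), then so is its localisation:
`m(π(u) · x) = u · m(x)`. [folklore] -/
theorem locMap_semilinear (π : A →ₐ[R] A') (m : A' →ₗ[R] A)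
    (hm : ∀ (a : A) (x : A'), m (π a * x) = a * m x) {n : ℕ} (t : Fin n → Fin s)
    (u : CechLoc y A t) (x : CechLoc y A' t) :
    locMap y m t (locMap y π.toLinearMap t u * x) = u * locMap y m t x := by
  induction u using LocalizedModule.induction_on with
  | h a₀ sa =>
  induction x using LocalizedModule.induction_on with
  | h x₀ sx =>
  rw [locMap_mk, LocalizedModule.mk_mul_mk, locMap_mk, locMap_mk, LocalizedModule.mk_mul_mk]
  simp [hm]

/-- An algebra homomorphism commutes with the twisted differentials (twist pushed forward).
[folklore] -/
theorem cechObjMap_dT (π : A →ₐ[R] A') (u : CechObj y A 1) (n : ℕ) (c : CechObj y A n) :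
    cechObjMap y π.toLinearMap (n + 1) (dT u n c) =
      dT (cechObjMap y π.toLinearMap 1 u) n (cechObjMap y π.toLinearMap n c) := by
  funext t
  rw [cechObjMap_apply, dT_apply, dT_apply, map_add, ← cechObjMap_apply, dC_cechObjMap,
    locMap_mul, map_sub, locMap_one]
  congr 2
  · unfold uAt
    rw [cechObjMap_apply, res_locMap_apply]
  · rw [cechObjMap_apply, res_locMap_apply]

/-- A `π`-semilinear `m : A' → A` intertwines the twist `π(u)` on `A'` with `u` on `A`.
[folklore] -/
theorem cechObjMap_dT_semilinear (π : A →ₐ[R] A') (m : A' →ₗ[R] A)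
    (hm : ∀ (a : A) (x : A'), m (π a * x) = a * m x) (u : CechObj y A 1) (n : ℕ)
    (c : CechObj y A' n) :
    cechObjMap y m (n + 1) (dT (cechObjMap y π.toLinearMap 1 u) n c) =
      dT u n (cechObjMap y m n c) := by
  funext t
  rw [cechObjMap_apply, dT_apply, dT_apply, map_add, ← cechObjMap_apply, dC_cechObjMap]
  congr 1
  rw [sub_mul, sub_mul, map_sub, one_mul, one_mul]
  congr 1
  · unfold uAt
    rw [cechObjMap_apply, res_locMap_apply, locMap_semilinear π m hm, cechObjMap_apply,
      res_locMap_apply]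
  · rw [cechObjMap_apply, res_locMap_apply]

end TwistedFunctor

/-! ### Units in the localisations; restriction of twists along faces -/

section UnitAux

variable {y M}
variable {A A' A'' : Type u} [CommRing A] [Algebra R A] [CommRing A'] [Algebra R A']
  [CommRing A''] [Algebra R A'']

/-- Restricting the edge-twist of a face gives the edge-twist of the simplex. [folklore] -/
theorem res_uAt (u : CechObj y A 1) {n n' : ℕ} (t : Fin (n + 1) → Fin s)
    (θ : Fin (n' + 1) → Fin (n + 1)) (a b : Fin (n' + 1)) :
    res y A t θ (uAt u (t ∘ θ) a b) = uAt u t (θ a) (θ b) := by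
  unfold uAt
  have h : θ ∘ ![a, b] = ![θ a, θ b] := by
    funext k; fin_cases k <;> rfl
  exact res_res_congr t θ ![a, b] h u

/-- If `m x · m x' = 0` in `A` (e.g. `m = g^k ·` into `A/g^{k+1}`, `2k ≥ k + 1`), the same holds
after localisation. [folklore] -/
theorem locMap_mul_locMap_eq_zero (m : A'' →ₗ[R] A) (hmm : ∀ x x' : A'', m x * m x' = 0)
    {n : ℕ} (t : Fin n → Fin s) (a b : CechLoc y A'' t) :
    locMap y m t a * locMap y m t b = 0 := by
  induction a using LocalizedModule.induction_on with
  | h a₀ sa =>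
  induction b using LocalizedModule.induction_on with
  | h b₀ sb =>
  rw [locMap_mk, locMap_mk, LocalizedModule.mk_mul_mk, hmm, LocalizedModule.zero_mk]

/-- **Units lift along a surjection with square-zero kernel**: if `A'' →m A →π A'` is exact with
`m(x) m(x') = 0`, and `π(x)` is a unit of `A'_{y_t}`, then `x` is a unit of `A_{y_t}`. [folklore] -/
theorem isUnit_of_isUnit_locMap (π : A →ₐ[R] A') (hπ : Function.Surjective π) (m : A'' →ₗ[R] A)
    (hex : Function.Exact m π.toLinearMap) (hmm : ∀ x x' : A'', m x * m x' = 0)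
    {n : ℕ} (t : Fin n → Fin s) (x : CechLoc y A t)
    (hx : IsUnit (locMap y π.toLinearMap t x)) : IsUnit x := by
  obtain ⟨wbar, hw⟩ := hx.exists_right_inv
  obtain ⟨w, rfl⟩ := locMap_surjective y π.toLinearMap hπ t wbar
  -- `π (x w - 1) = 0`, so `x w = 1 + n` with `n² = 0`
  have h1 : locMap y π.toLinearMap t (x * w - 1) = 0 := by
    rw [map_sub, locMap_mul, hw, locMap_one, sub_self]
  obtain ⟨n'', hn⟩ := (locMap_exact y m π.toLinearMap hex t _).mp h1
  refine IsUnit.of_mul_eq_one (w * (1 - locMap y m t n'')) ?_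
  have hxw : x * w = 1 + locMap y m t n'' := by rw [hn]; ring
  calc x * (w * (1 - locMap y m t n'')) = (x * w) * (1 - locMap y m t n'') := by ring
    _ = 1 - locMap y m t n'' * locMap y m t n'' := by rw [hxw]; ring
    _ = 1 := by rw [locMap_mul_locMap_eq_zero m hmm, sub_zero]

/-- The cocycle condition in edge form: `u(0,1) u(1,2) = u(0,2)` on every `2`-simplex. [folklore] -/
theorem IsMulCocycle.uAt_mul {u : CechObj y A 1} (hu : IsMulCocycle u) (t : Fin 3 → Fin s) :
    uAt u t 0 1 * uAt u t 1 2 = uAt u t 0 2 := by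
  have h12 : uAt u t 1 2 = res y A t (Fin.succAbove 0) (u (t ∘ Fin.succAbove 0)) := by
    unfold uAt
    exact res_congr t (show (![1, 2] : Fin 2 → Fin 3) = Fin.succAbove 0 from by
      funext k; fin_cases k <;> rfl) u
  have h02 : uAt u t 0 2 = res y A t (Fin.succAbove 1) (u (t ∘ Fin.succAbove 1)) := by
    unfold uAt
    exact res_congr t (show (![0, 2] : Fin 2 → Fin 3) = Fin.succAbove 1 from by
      funext k; fin_cases k <;> rfl) u
  rw [h12, h02]
  exact hu t

/-- Conversely the edge form gives the cocycle condition. [folklore] -/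
theorem isMulCocycle_of_uAt_mul {u : CechObj y A 1}
    (hu : ∀ t : Fin 3 → Fin s, uAt u t 0 1 * uAt u t 1 2 = uAt u t 0 2) : IsMulCocycle u := by
  intro t
  have h12 : uAt u t 1 2 = res y A t (Fin.succAbove 0) (u (t ∘ Fin.succAbove 0)) := by
    unfold uAt
    exact res_congr t (show (![1, 2] : Fin 2 → Fin 3) = Fin.succAbove 0 from by
      funext k; fin_cases k <;> rfl) u
  have h02 : uAt u t 0 2 = res y A t (Fin.succAbove 1) (u (t ∘ Fin.succAbove 1)) := by
    unfold uAt
    exact res_congr t (show (![0, 2] : Fin 2 → Fin 3) = Fin.succAbove 1 from by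
      funext k; fin_cases k <;> rfl) u
  rw [← h12, ← h02]
  exact hu t

/-- `uAt` is additive and multiplicative in the cochain (it is a restriction map). [folklore] -/
theorem uAt_add (u v : CechObj y A 1) {n : ℕ} (t : Fin (n + 1) → Fin s) (a b : Fin (n + 1)) :
    uAt (u + v) t a b = uAt u t a b + uAt v t a b := by
  unfold uAt; rw [Pi.add_apply, map_add]

/-- `uAt` is multiplicative in the cochain. [folklore] -/
theorem uAt_mul (u v : CechObj y A 1) {n : ℕ} (t : Fin (n + 1) → Fin s) (a b : Fin (n + 1)) :
    uAt (u * v) t a b = uAt u t a b * uAt v t a b := by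
  unfold uAt; rw [Pi.mul_apply, res_mul]

/-- `uAt 1 = 1`. [folklore] -/
theorem uAt_one {n : ℕ} (t : Fin (n + 1) → Fin s) (a b : Fin (n + 1)) :
    uAt (1 : CechObj y A 1) t a b = 1 := by
  unfold uAt; rw [Pi.one_apply, res_one]

/-- `uAt` commutes with `cechObjMap`. [folklore] -/
theorem locMap_uAt {N : Type u} [AddCommGroup N] [Module R N] (φ : A →ₗ[R] N) (u : CechObj y A 1)
    {n : ℕ} (t : Fin (n + 1) → Fin s) (a b : Fin (n + 1)) :
    locMap y φ t (uAt u t a b) = res y N t ![a, b] (cechObjMap y φ 1 u (t ∘ ![a, b])) := by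
  unfold uAt
  rw [cechObjMap_apply, res_locMap_apply]

end UnitAux

/-! ### Lifting unit cocycles (SGA 2 XI 3.16 ⇒ 3.13: `Pic(U_{k+1}) → Pic(U_k)` onto when `H³_𝔪 = 0`) -/

section Lifting

variable {y M}
variable {A A' A'' : Type u} [CommRing A] [Algebra R A] [CommRing A'] [Algebra R A']
  [CommRing A''] [Algebra R A'']

/-- `uAt` is compatible with subtraction. [folklore] -/
theorem uAt_sub (u v : CechObj y A 1) {n : ℕ} (t : Fin (n + 1) → Fin s) (a b : Fin (n + 1)) :
    uAt (u - v) t a b = uAt u t a b - uAt v t a b := by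
  unfold uAt; rw [Pi.sub_apply, map_sub]

/-- Edge-twists of a cochain in the image of `m` are in the image of `m`. [folklore] -/
theorem uAt_cechObjMap_mem_range (m : A'' →ₗ[R] A) (v : CechObj y A'' 1) {n : ℕ}
    (t : Fin (n + 1) → Fin s) (a b : Fin (n + 1)) :
    uAt (cechObjMap y m 1 v) t a b ∈ LinearMap.range (locMap y m t) := by
  unfold uAt
  rw [cechObjMap_apply, res_locMap_apply]
  exact LinearMap.mem_range_self _ _

/-- Face-restrictions of a cochain in the image of `m` are in the image of `m`. [folklore] -/
theorem res_cechObjMap_mem_range (m : A'' →ₗ[R] A) {k : ℕ} (z : CechObj y A'' k) {n : ℕ}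
    (t : Fin n → Fin s) (θ : Fin (k + 1) → Fin n) :
    res y A t θ (cechObjMap y m k z (t ∘ θ)) ∈ LinearMap.range (locMap y m t) := by
  rw [cechObjMap_apply, res_locMap_apply]
  exact LinearMap.mem_range_self _ _

/-- Products of elements of the image of a square-zero `m` vanish. [folklore] -/
theorem mul_eq_zero_of_mem_range (m : A'' →ₗ[R] A) (hmm : ∀ x x' : A'', m x * m x' = 0)
    {n : ℕ} (t : Fin n → Fin s) {a b : CechLoc y A t}
    (ha : a ∈ LinearMap.range (locMap y m t)) (hb : b ∈ LinearMap.range (locMap y m t)) :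
    a * b = 0 := by
  obtain ⟨a, rfl⟩ := ha
  obtain ⟨b, rfl⟩ := hb
  exact locMap_mul_locMap_eq_zero m hmm t a b

/-- The differential of a `1`-cochain in edge form:
`(d w)(i,j,k) = w(1,2) - w(0,2) + w(0,1)`. [folklore] -/
theorem dC_one_eq_uAt (w : CechObj y A 1) (t : Fin 3 → Fin s) :
    dC 1 w t = uAt w t 1 2 - uAt w t 0 2 + uAt w t 0 1 := by
  rw [dC_apply, Fin.sum_univ_three]
  simp only [Fin.val_zero, pow_zero, one_smul, Fin.val_one, pow_one, neg_smul, one_smul,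
    Fin.val_two]
  norm_num
  have h12 : uAt w t 1 2 = res y A t (Fin.succAbove 0) (w (t ∘ Fin.succAbove 0)) := by
    unfold uAt
    exact res_congr t (show (![1, 2] : Fin 2 → Fin 3) = Fin.succAbove 0 from by
      funext k; fin_cases k <;> rfl) w
  have h02 : uAt w t 0 2 = res y A t (Fin.succAbove 1) (w (t ∘ Fin.succAbove 1)) := by
    unfold uAt
    exact res_congr t (show (![0, 2] : Fin 2 → Fin 3) = Fin.succAbove 1 from by
      funext k; fin_cases k <;> rfl) w
  have h01 : uAt w t 0 1 = res y A t (Fin.succAbove 2) (w (t ∘ Fin.succAbove 2)) := by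
    unfold uAt
    exact res_congr t (show (![0, 1] : Fin 2 → Fin 3) = Fin.succAbove 2 from by
      funext k; fin_cases k <;> rfl) w
  rw [h12, h02, h01]
  ring

/-- **Lifting of unit cocycles** (the surjectivity `Pic(U_{k+1}) → Pic(U_k)` of SGA 2 XI 3.16 in
Čech form). Let `A'' →m A →π A'` be exact with `π` a surjective algebra map, `m` injective and
`m(x)m(x') = 0` (e.g. `A = S/g^{k+1}`, `A' = S/g^k`, `A'' = S/g`, `m = g^k·`), and assume every
Čech `2`-cocycle of `A''` is a coboundary (`H³_𝔪(A'') = 0`). Then every multiplicative unit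
`1`-cocycle `ū` of `A'` lifts to a multiplicative unit `1`-cocycle `u` of `A`. Proof: lift `ū`
to units `ũ`; the defect `z = ũ₀₁ũ₁₂ũ₀₂⁻¹ - 1` lies in `m(Č²(A''))`, is a `2`-cocycle (products
of defects vanish), hence `z = d(m(v))`, and `u = ũ(1 - m(v))` works. [cite: Grothendieck1968SGA2,
Exp. XI, Lemme 3.16 and proof of Thm. 3.13] -/
theorem exists_lift_mulCocycle (π : A →ₐ[R] A') (hπ : Function.Surjective π) (m : A'' →ₗ[R] A)
    (hex : Function.Exact m π.toLinearMap) (hminj : Function.Injective m)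
    (hmm : ∀ x x' : A'', m x * m x' = 0)
    (hA'' : ∀ z : CechObj y A'' 2, dC 2 z = 0 → ∃ v : CechObj y A'' 1, dC 1 v = z)
    (ubar : CechObj y A' 1) (hcoc : IsMulCocycle ubar) (hunit : ∀ t, IsUnit (ubar t)) :
    ∃ u : CechObj y A 1, IsMulCocycle u ∧ (∀ t, IsUnit (u t)) ∧
      cechObjMap y π.toLinearMap 1 u = ubar := by
  classical
  -- lift `ū` to a cochain of units `ut`, with inverse cochain `vt`
  obtain ⟨ut, hut⟩ := cechObjMap_surjective y π.toLinearMap hπ 1 ubar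
  have hutu : ∀ t, IsUnit (ut t) := fun t =>
    isUnit_of_isUnit_locMap π hπ m hex hmm t (ut t)
      (by rw [← cechObjMap_apply, hut]; exact hunit t)
  choose vt hvt using fun t => (hutu t).exists_right_inv
  have hUV : ∀ {n : ℕ} (t : Fin (n + 1) → Fin s) (a b : Fin (n + 1)),
      uAt ut t a b * uAt vt t a b = 1 := by
    intro n t a b
    rw [← uAt_mul]
    have : ut * vt = 1 := funext fun t => hvt t
    rw [this, uAt_one]
  have hπU : ∀ {n : ℕ} (t : Fin (n + 1) → Fin s) (a b : Fin (n + 1)),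
      locMap y π.toLinearMap t (uAt ut t a b) = uAt ubar t a b := by
    intro n t a b
    rw [locMap_uAt, hut]
    rfl
  -- the defect cochain
  set z : CechObj y A 2 := fun t => uAt ut t 0 1 * uAt ut t 1 2 * uAt vt t 0 2 - 1 with hzdef
  have hz : ∀ t, z t = uAt ut t 0 1 * uAt ut t 1 2 * uAt vt t 0 2 - 1 := fun t => rfl
  -- `π z = 0`
  have hπz : cechObjMap y π.toLinearMap 2 z = 0 := by
    funext t
    rw [cechObjMap_apply, Pi.zero_apply, hz, map_sub, locMap_one, locMap_mul, locMap_mul, hπU,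
      hπU, hcoc.uAt_mul, ← hπU, ← locMap_mul, hUV, locMap_one, sub_self]
  -- hence `z = m z''`
  obtain ⟨z'', hz''⟩ := (cechObjMap_exact y m π.toLinearMap hex 2 z).mp hπz
  have hzr : ∀ {n : ℕ} (t : Fin n → Fin s) (θ : Fin 3 → Fin n),
      res y A t θ (z (t ∘ θ)) ∈ LinearMap.range (locMap y m t) := by
    intro n t θ
    rw [← hz'']
    exact res_cechObjMap_mem_range m z'' t θ
  -- `z` is a `2`-cocycle
  have hdz : dC 2 z = 0 := by
    funext t
    rw [Pi.zero_apply, dC_apply, Fin.sum_univ_four]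
    simp only [Fin.val_zero, pow_zero, one_smul, Fin.val_one, pow_one, neg_smul, one_smul,
      Fin.val_two]
    norm_num
    -- restrict the four faces
    have face : ∀ i : Fin 4, res y A t (Fin.succAbove i) (z (t ∘ Fin.succAbove i)) =
        uAt ut t (Fin.succAbove i 0) (Fin.succAbove i 1) *
          uAt ut t (Fin.succAbove i 1) (Fin.succAbove i 2) *
          uAt vt t (Fin.succAbove i 0) (Fin.succAbove i 2) - 1 := by
      intro i
      rw [hz, map_sub, res_one, res_mul, res_mul, res_uAt, res_uAt, res_uAt]
    have n1 := mul_eq_zero_of_mem_range m hmm t (hzr t (Fin.succAbove 3)) (hzr t (Fin.succAbove 1))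
    have n2 := mul_eq_zero_of_mem_range m hmm t (hzr t (Fin.succAbove 0)) (hzr t (Fin.succAbove 2))
    rw [face, face] at n1 n2
    rw [face, face, face, face]
    have s00 : Fin.succAbove (0 : Fin 4) (0 : Fin 3) = 1 := by decide
    have s01 : Fin.succAbove (0 : Fin 4) (1 : Fin 3) = 2 := by decide
    have s02 : Fin.succAbove (0 : Fin 4) (2 : Fin 3) = 3 := by decide
    have s10 : Fin.succAbove (1 : Fin 4) (0 : Fin 3) = 0 := by decide
    have s11 : Fin.succAbove (1 : Fin 4) (1 : Fin 3) = 2 := by decide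
    have s12 : Fin.succAbove (1 : Fin 4) (2 : Fin 3) = 3 := by decide
    have s20 : Fin.succAbove (2 : Fin 4) (0 : Fin 3) = 0 := by decide
    have s21 : Fin.succAbove (2 : Fin 4) (1 : Fin 3) = 1 := by decide
    have s22 : Fin.succAbove (2 : Fin 4) (2 : Fin 3) = 3 := by decide
    have s30 : Fin.succAbove (3 : Fin 4) (0 : Fin 3) = 0 := by decide
    have s31 : Fin.succAbove (3 : Fin 4) (1 : Fin 3) = 1 := by decide
    have s32 : Fin.succAbove (3 : Fin 4) (2 : Fin 3) = 2 := by decide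
    simp only [s00, s01, s02, s10, s11, s12, s20, s21, s22, s30, s31, s32] at n1 n2 ⊢
    have h02 := hUV t 0 2
    have h13 := hUV t 1 3
    linear_combination (-(uAt ut t 0 1 * uAt ut t 1 2 * uAt ut t 2 3 * uAt vt t 0 3)) * h02 +
      (uAt ut t 0 1 * uAt ut t 1 2 * uAt ut t 2 3 * uAt vt t 0 3) * h13 + n1 - n2
  -- so `z''` is a cocycle of `A''`, hence a coboundary `z'' = d v''`
  have hdz'' : dC 2 z'' = 0 := by
    apply cechObjMap_injective y m hminj 3
    rw [← dC_cechObjMap, hz'', hdz, map_zero]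
  obtain ⟨v'', hv''⟩ := hA'' z'' hdz''
  set w : CechObj y A 1 := cechObjMap y m 1 v'' with hwdef
  have hdw : dC 1 w = z := by rw [hwdef, dC_cechObjMap, hv'', hz'']
  have hwr : ∀ {n : ℕ} (t : Fin (n + 1) → Fin s) (a b : Fin (n + 1)),
      uAt w t a b ∈ LinearMap.range (locMap y m t) := fun t a b =>
    uAt_cechObjMap_mem_range m v'' t a b
  -- the corrected lift
  refine ⟨ut * (1 - w), ?_, ?_, ?_⟩
  · -- cocycle
    apply isMulCocycle_of_uAt_mul
    intro t
    simp only [uAt_mul, uAt_sub, uAt_one]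
    have hzt : z t = uAt w t 1 2 - uAt w t 0 2 + uAt w t 0 1 := by rw [← hdw, dC_one_eq_uAt]
    rw [hz] at hzt
    -- products of elements of `m(…)` vanish
    have hzm : uAt ut t 0 1 * uAt ut t 1 2 * uAt vt t 0 2 - 1 ∈ LinearMap.range (locMap y m t) := by
      rw [← hz]
      have := hzr t id
      rwa [res_id] at this
    have p1 := mul_eq_zero_of_mem_range m hmm t hzm (hwr t 0 1)
    have p2 := mul_eq_zero_of_mem_range m hmm t hzm (hwr t 1 2)
    have p3 := mul_eq_zero_of_mem_range m hmm t (hwr t 0 1) (hwr t 1 2)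
    have h02 := hUV t 0 2
    linear_combination (uAt ut t 0 2) * hzt + (uAt ut t 0 1 * uAt ut t 1 2) * p3 +
      (-(uAt ut t 0 1 * uAt ut t 1 2) + uAt ut t 0 1 * uAt ut t 1 2 * uAt w t 0 1 +
        uAt ut t 0 1 * uAt ut t 1 2 * uAt w t 1 2) * h02 +
      (-(uAt ut t 0 2)) * p1 + (-(uAt ut t 0 2)) * p2
  · -- units
    intro t
    rw [Pi.mul_apply, Pi.sub_apply, Pi.one_apply]
    refine (hutu t).mul (IsUnit.of_mul_eq_one (1 + w t) ?_)
    have : w t * w t = 0 := by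
      rw [hwdef, cechObjMap_apply]
      exact locMap_mul_locMap_eq_zero m hmm _ _ _
    linear_combination (-1 : CechLoc y A t) * this
  · -- reduction
    funext t
    have h0 : locMap y π.toLinearMap t (w t) = 0 := by
      rw [hwdef, cechObjMap_apply]
      exact (locMap_exact y m π.toLinearMap hex t).apply_apply_eq_zero (v'' t)
    have h1 : locMap y π.toLinearMap t (ut t) = ubar t := by rw [← cechObjMap_apply, hut]
    rw [cechObjMap_apply, Pi.mul_apply, locMap_mul, Pi.sub_apply, map_sub, Pi.one_apply,
      locMap_one, h0, h1, sub_zero, mul_one]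

end Lifting

/-! ### Twisted sections, twisted `H²`, and the obstruction to lifting sections -/

section Obstruction

variable {y M}
variable {A A' A'' : Type u} [CommRing A] [Algebra R A] [CommRing A'] [Algebra R A']
  [CommRing A''] [Algebra R A'']

/-- Twisted sections `Γ(U, L_u) = ker(d_u : Č⁰ → Č¹)`. [folklore] -/
abbrev TZ0 (u : CechObj y A 1) : Submodule R (CechObj y A 0) := LinearMap.ker (dT u 0)

/-- Twisted `1`-cocycles. [folklore] -/
abbrev TZ1 (u : CechObj y A 1) : Submodule R (CechObj y A 1) := LinearMap.ker (dT u 1)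

/-- Twisted `1`-coboundaries, as a submodule of the cocycles. [folklore] -/
abbrev TB1 (u : CechObj y A 1) : Submodule R (TZ1 u) :=
  (LinearMap.range (dT u 0)).comap (TZ1 u).subtype

/-- Twisted second local cohomology `H¹(U, L_u) = H²_𝔪` (position `2`): `TZ1/TB1`. [folklore] -/
abbrev TH2 (u : CechObj y A 1) : Type u := TZ1 u ⧸ TB1 u

/-- The class of a twisted cocycle. [folklore] -/
abbrev TH2.mk (u : CechObj y A 1) (ζ : CechObj y A 1) (hζ : dT u 1 ζ = 0) : TH2 u :=
  (TB1 u).mkQ ⟨ζ, hζ⟩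

/-- A twisted class vanishes iff the cocycle is a twisted coboundary. [folklore] -/
theorem TH2.mk_eq_zero_iff (u : CechObj y A 1) (ζ : CechObj y A 1) (hζ : dT u 1 ζ = 0) :
    TH2.mk u ζ hζ = 0 ↔ ∃ ξ : CechObj y A 0, dT u 0 ξ = ζ := by
  simp [Submodule.Quotient.mk_eq_zero, TB1, LinearMap.mem_range]

/-- `TH2.mk` is additive. [folklore] -/
theorem TH2.mk_add (u : CechObj y A 1) (ζ ζ' : CechObj y A 1) (hζ : dT u 1 ζ = 0)
    (hζ' : dT u 1 ζ' = 0) :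
    TH2.mk u (ζ + ζ') (by rw [map_add, hζ, hζ', add_zero]) = TH2.mk u ζ hζ + TH2.mk u ζ' hζ' :=
  rfl

/-- `TH2.mk` is homogeneous. [folklore] -/
theorem TH2.mk_smul (u : CechObj y A 1) (r : R) (ζ : CechObj y A 1) (hζ : dT u 1 ζ = 0) :
    TH2.mk u (r • ζ) (by rw [LinearMap.map_smul, hζ, smul_zero]) = r • TH2.mk u ζ hζ :=
  rfl

variable (π : A →ₐ[R] A') (m : A'' →ₗ[R] A) (u : CechObj y A 1) (w : CechObj y A'' 1)

/-- **The obstruction relation.** For the thickening `A'' →m A →π A'` (`m` semilinear for the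
reduction `ρ : A → A''`) with twist `u` on `A` reducing to the twist `w = ρ(u)` on `A''`, the
section `σ` of the reduced bundle has obstruction class `e ∈ H²(A'', w)` if some cochain lift
`σ̃` of `σ` has `d_u σ̃ = m(ζ)` with `[ζ] = e`. [cite: Grothendieck1968SGA2, Exp. XI, proof of 3.16] -/
def IsObs (σ : CechObj y A' 0) (e : TH2 w) : Prop :=
  ∃ (σt : CechObj y A 0) (ζ : CechObj y A'' 1) (hζ : dT w 1 ζ = 0),
    cechObjMap y π.toLinearMap 0 σt = σ ∧ dT u 0 σt = cechObjMap y m 1 ζ ∧ e = TH2.mk w ζ hζ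

variable {π m u w}

/-- Every section of the reduced bundle has an obstruction class. [folklore] -/
theorem IsObs.exists (ρ : A →ₐ[R] A'') (hw : cechObjMap y ρ.toLinearMap 1 u = w)
    (hπ : Function.Surjective π) (hex : Function.Exact m π.toLinearMap)
    (hminj : Function.Injective m) (hm : ∀ (a : A) (x : A''), m (ρ a * x) = a * m x)
    (hu : IsMulCocycle u) (σ : CechObj y A' 0)
    (hσ : dT (cechObjMap y π.toLinearMap 1 u) 0 σ = 0) :
    ∃ e, IsObs π m u w σ e := by
  obtain ⟨σt, rfl⟩ := cechObjMap_surjective y π.toLinearMap hπ 0 σ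
  have h1 : cechObjMap y π.toLinearMap 1 (dT u 0 σt) = 0 := by rw [cechObjMap_dT, hσ]
  obtain ⟨ζ, hζ⟩ := (cechObjMap_exact y m π.toLinearMap hex 1 _).mp h1
  have hζc : dT w 1 ζ = 0 := by
    apply cechObjMap_injective y m hminj 2
    rw [← hw, cechObjMap_dT_semilinear ρ m hm, hζ, dT_one_dT_zero u hu, map_zero]
  exact ⟨_, σt, ζ, hζc, rfl, hζ.symm, rfl⟩

/-- A section with obstruction class `0` lifts to a section. [folklore] -/
theorem IsObs.exists_lift (ρ : A →ₐ[R] A'') (hw : cechObjMap y ρ.toLinearMap 1 u = w)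
    (hm : ∀ (a : A) (x : A''), m (ρ a * x) = a * m x)
    (hex : Function.Exact m π.toLinearMap) {σ : CechObj y A' 0} (h : IsObs π m u w σ 0) :
    ∃ σ' : CechObj y A 0, dT u 0 σ' = 0 ∧ cechObjMap y π.toLinearMap 0 σ' = σ := by
  obtain ⟨σt, ζ, hζ, hσt, hd, he⟩ := h
  obtain ⟨ξ, hξ⟩ := (TH2.mk_eq_zero_iff w ζ hζ).mp he.symm
  refine ⟨σt - cechObjMap y m 0 ξ, ?_, ?_⟩
  · rw [map_sub, hd, ← cechObjMap_dT_semilinear ρ m hm, hw, hξ, sub_self]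
  · rw [map_sub, hσt, sub_eq_self]
    funext t
    rw [cechObjMap_apply, cechObjMap_apply, Pi.zero_apply]
    exact (locMap_exact y m π.toLinearMap hex t).apply_apply_eq_zero _

/-- A section that lifts has obstruction class `0`. [folklore] -/
theorem IsObs.zero_of_lift {σ : CechObj y A' 0} (σ' : CechObj y A 0) (hσ' : dT u 0 σ' = 0)
    (hπσ : cechObjMap y π.toLinearMap 0 σ' = σ) : IsObs π m u w σ 0 :=
  ⟨σ', 0, by rw [map_zero], hπσ, by rw [hσ', map_zero], by
    symm; rw [TH2.mk_eq_zero_iff]; exact ⟨0, by rw [map_zero]⟩⟩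

/-- Obstruction classes add. [folklore] -/
theorem IsObs.add {σ σ' : CechObj y A' 0} {e e' : TH2 w}
    (h : IsObs π m u w σ e) (h' : IsObs π m u w σ' e') : IsObs π m u w (σ + σ') (e + e') := by
  obtain ⟨σt, ζ, hζ, rfl, hd, rfl⟩ := h
  obtain ⟨σt', ζ', hζ', rfl, hd', rfl⟩ := h'
  exact ⟨σt + σt', ζ + ζ', by rw [map_add, hζ, hζ', add_zero], by rw [map_add],
    by rw [map_add, hd, hd', map_add], (TH2.mk_add w ζ ζ' hζ hζ').symm⟩

/-- Obstruction classes scale. [folklore] -/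
theorem IsObs.smul {σ : CechObj y A' 0} {e : TH2 w} (h : IsObs π m u w σ e) (r : R) :
    IsObs π m u w (r • σ) (r • e) := by
  obtain ⟨σt, ζ, hζ, rfl, hd, rfl⟩ := h
  exact ⟨r • σt, r • ζ, by rw [LinearMap.map_smul, hζ, smul_zero], by rw [LinearMap.map_smul],
    by rw [LinearMap.map_smul, hd, LinearMap.map_smul], (TH2.mk_smul w r ζ hζ).symm⟩

/-- Obstruction classes negate. [folklore] -/
theorem IsObs.neg {σ : CechObj y A' 0} {e : TH2 w} (h : IsObs π m u w σ e) :
    IsObs π m u w (-σ) (-e) := by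
  have := h.smul (-1)
  rwa [neg_one_smul, neg_one_smul] at this

/-- Obstruction classes subtract. [folklore] -/
theorem IsObs.sub {σ σ' : CechObj y A' 0} {e e' : TH2 w}
    (h : IsObs π m u w σ e) (h' : IsObs π m u w σ' e') : IsObs π m u w (σ - σ') (e - e') := by
  rw [sub_eq_add_neg, sub_eq_add_neg]
  exact h.add h'.neg

variable (π m u w) in
/-- The set of obstruction classes of sections is a submodule `F ⊆ H²(A'', w)`. [folklore] -/
def obsSubmodule : Submodule R (TH2 w) where
  carrier := {e | ∃ σ, dT (cechObjMap y π.toLinearMap 1 u) 0 σ = 0 ∧ IsObs π m u w σ e}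
  add_mem' := by
    rintro e e' ⟨σ, hσ, h⟩ ⟨σ', hσ', h'⟩
    exact ⟨σ + σ', by rw [map_add, hσ, hσ', add_zero], h.add h'⟩
  zero_mem' := ⟨0, by rw [map_zero], IsObs.zero_of_lift 0 (by rw [map_zero]) (by rw [map_zero])⟩
  smul_mem' := by
    rintro r e ⟨σ, hσ, h⟩
    exact ⟨r • σ, by rw [LinearMap.map_smul, hσ, smul_zero], h.smul r⟩

/-- Membership in the obstruction submodule. [folklore] -/
theorem mem_obsSubmodule_iff (e : TH2 w) :
    e ∈ obsSubmodule π m u w ↔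
      ∃ σ, dT (cechObjMap y π.toLinearMap 1 u) 0 σ = 0 ∧ IsObs π m u w σ e :=
  Iff.rfl

/-- **Compatibility of obstructions with the thickening maps `γ = g^L·`**: if `σ` (a section
over the thickening `A →π A'`) has obstruction class `e`, then `γ'(σ)` (a section over the
thickening `A₂ →π₂ A₃`, `L` levels up) has the same obstruction class. Here `γ' : A' → A₃`,
`γ : A → A₂` are the multiplications by `g^L` (`π₂ γ = γ' π`, `γ m = m₂`, `γ` semilinear for the
reduction `θ : A₂ → A`, and `u = θ(u₂)`). [folklore] -/
theorem IsObs.map_gamma {A₂ A₃ : Type u} [CommRing A₂] [Algebra R A₂] [CommRing A₃] [Algebra R A₃]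
    (π₂ : A₂ →ₐ[R] A₃) (m₂ : A'' →ₗ[R] A₂) (u₂ : CechObj y A₂ 1) (θ : A₂ →ₐ[R] A)
    (γ' : A' →ₗ[R] A₃) (γ : A →ₗ[R] A₂)
    (r1 : π₂.toLinearMap ∘ₗ γ = γ' ∘ₗ π.toLinearMap) (r2 : γ ∘ₗ m = m₂)
    (r3 : ∀ (a : A₂) (x : A), γ (θ a * x) = a * γ x)
    (hu : cechObjMap y θ.toLinearMap 1 u₂ = u) {σ : CechObj y A' 0} {e : TH2 w}
    (h : IsObs π m u w σ e) : IsObs π₂ m₂ u₂ w (cechObjMap y γ' 0 σ) e := by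
  obtain ⟨σt, ζ, hζ, rfl, hd, rfl⟩ := h
  refine ⟨cechObjMap y γ 0 σt, ζ, hζ, ?_, ?_, rfl⟩
  · rw [← LinearMap.comp_apply, ← cechObjMap_comp, r1, cechObjMap_comp, LinearMap.comp_apply]
  · rw [← cechObjMap_dT_semilinear θ γ r3 u₂, hu, hd, ← LinearMap.comp_apply,
      ← cechObjMap_comp, r2]

end Obstruction

end Literature.RingTheory.LocalCohomology

end
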